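import Summits.AtomisticToContinuum.BoseEinsteinCondensation.Theorems.BoxHorizonAffinity

/-!
# PART B of lens-6 g34 `land/BoxHorizonAffinity.lean` (lines 328–617, sha256 9601ffd153b75c38…)

§9 the pieces at the HORIZON scale and the deciding kernels (`bec_of_twoScaleAffinity` etc.).
(Split for the 400-line rule by prover hand 1, gen 11, decomp-a2c LOW lane; declarations byte-identical; gate-forced deltas: cite-key syntax of
`GroundStateHorizonLabelAffinity`'s docstring, private copy of `tendsto_sideLength_succ_atTop`, one local rpow have; module docstring of record in PART A.)
-/

noncomputable section

open MeasureTheory Filter Set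
open scoped ENNReal NNReal BigOperators

namespace Summit.AtomisticToContinuum.BoseEinsteinCondensation.Theorems.BoxHorizonAffinity

open Literature.MathematicalPhysics.QuantumManyBody.BoseGas
open Summit.AtomisticToContinuum.BoseEinsteinCondensation.Theorems.BoxLatticeFSum
open Summit.AtomisticToContinuum.BoseEinsteinCondensation.Theorems.BoxLabelAffinity

variable {n : ℕ}
variable {K j : ℕ} {ℓ : ℝ}

/-- `L_N = (N/ρ)^{1/3} → ∞` along `N = n + 1` (private copy: Part I's lemma is private after the gate's dedup against
`PuffFloorSolidCore.tendsto_sideLength_succ`). [folklore] -/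
private theorem tendsto_sideLength_succ_atTop {ρ : ℝ} (hρ : 0 < ρ) :
    Tendsto (fun n : ℕ => sideLength ρ (n + 1)) atTop atTop := by
  have h : Tendsto (fun N : ℕ => sideLength ρ N) atTop atTop :=
    (tendsto_rpow_atTop (by norm_num : (0 : ℝ) < 1 / 3)).comp
      (tendsto_natCast_atTop_atTop.atTop_div_const hρ)
  exact h.comp (tendsto_add_atTop_nat 1)

/-! ### §9  The pieces at the HORIZON scale and the deciding kernels

The horizon window for the block side is `L/K ∈ [Mρ^{-η}/√ρ, 2Mρ^{-η}/√ρ]` — the tree's `InWindow` with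
the density-dependent constant `Mρ^{-η}`; at `η = 0` it is the GP window and the pieces below ARE g33's
(`…_zero_iff`).  Physically `M ≍ a^{-1/2}(a³)^{-η}·M₀` puts the block side at `M₀ · a(ρa³)^{-1/2-η} = M₀·L_J`,
Junge's localisation length [Junge2026, Cor. 6]; the `a`-dependence is absorbed in `M`, which is quantified
after `v`. -/

/-- **LOC_h(η)** (piece · TAG ENERGY-CLASS · TRUE-type · WEAKER · leaf ATTACKABLE·L; `= LOC ∧ TSD(η)` by
`horizonCondensation_of_loc_twoScale`) `GroundStateHorizonCondensation η`: for `a > 0`, every target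
depletion `s > 0` and every horizon constant `M > 0`, below a density cap, eventually in `N`, the nonnegative
ground state has block depletion `≤ s` for every block number `K` of the HORIZON window
`L/K ∈ [Mρ^{-η}/√ρ, 2Mρ^{-η}/√ρ]`: all but `sN` particles sit in the flat modes of their own horizon blocks
(side `≍ L_J·const` for `η = η_J`).  Local BEC on boxes of side `R ∈ [L_J, R_E]` is exactly the sighted region
of the pinned-LHY energy method [Junge2026, Cor. 6 (26): `⟨n₊⟩/N ≤ C ρR²a(ρa³)^{1/2+η_J}` for
`R ≥ L_J = a(ρa³)^{-1/2-η_J}`, which `→ 0` at `R = M₀L_J` since `ρL_J²a(ρa³)^{1/2+η_J} = (ρa³)^{1/2-η_J}`].  Why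
it might fail: as LOC (sector-wise transfer from Neumann boxes in print to blocks of the Dirichlet minimiser of
the big box; hard cores [Fournais–Solovej II]-class) — and for `η` beyond `1/4 + η_J/2` the printed bound no
longer tends to zero.  WEAKER than the conjunct: a horizon-block-wise phase-disordered condensate satisfies it.
[cite: Junge2026, Cor. 6 (26); LSSY2005, Thm 7.1] -/
@[conjecture] def GroundStateHorizonCondensation (η : ℝ≥0) : Prop :=
  ∀ v : ℝ → ℝ≥0∞, IsRepulsiveFiniteRange v → 0 < scatteringLength v →
    ∀ s : ℝ, 0 < s → ∀ M : ℝ, 0 < M → ∃ ρ₀ : ℝ, 0 < ρ₀ ∧ ∀ ρ : ℝ, 0 < ρ → ρ < ρ₀ →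
      ∀ᶠ n : ℕ in atTop,
        (∃ Ψ₀ : Config (n + 1) → ℝ, (∀ X, 0 ≤ Ψ₀ X) ∧
          IsGroundState v (sideLength ρ (n + 1)) (fun X => (Ψ₀ X : ℂ))) →
        ∀ K : ℕ, 0 < K → InWindow (M * ρ ^ (-(η : ℝ))) ρ (sideLength ρ (n + 1)) K →
          blockDepletion (sideLength ρ (n + 1)) K (groundState v (n + 1) (sideLength ρ (n + 1))) ≤
            ENNReal.ofReal s

/-- **TSD(η)** (piece · TAG ENERGY-CLASS · FACT-BACKED · TRUE-type · WEAKER · leaf ATTACKABLE·L)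
`GroundStateTwoScaleDepletion η`: for `a > 0`, every `s > 0`, horizon constant `M > 0` and GP constant
`A > 0`, below a density cap, eventually in `N`, for every `K` of the horizon window and every nested
refinement `K·j` in the GP window, the COARSE depletion exceeds the FINE one by at most `s`:
`D(K) ≤ D(Kj) + s`.  Since `D(K) − D(Kj) = (1/N)(Σ_C n(u_C) − Σ_P n(u_P))` (children block-flat modes
minus parent block-flat modes; `∫ m_B² dY = n(u_B)/N` for real `Φ`, the identity behind `blockDepletion`), this
is the density-currency form of the superblock depletion `sbDepletion/N` of the tree's `HorizonLocalDepletion`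
(lens-6 g31, `Theorems/BoxHorizonTransfer.lean`: superblock factor `m = j`, fine block number `K·j`; identity of
definitions, not type-checked here) read for the ground state — Junge's strong local condensation
[Junge2026, Cor. 6 (26)], in the tree as the named fact `Junge2026_neumannLargeBox_pinnedLowerBound`
(`Literature/MathematicalPhysics/QuantumManyBody/NeumannLargeBoxCondensation.lean`).  g31's LD gives it for
every `η ≤ 1/4` (coarse side `R = jA/√ρ`: `D(K) − D(Kj) ≤ C₂ρR²a(ρa³)^{1/2+η_J}`).  Why it might fail: the printed bound is for radially non-increasing `v ∈ L¹` on ONE Neumann box at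
fixed `N = ρR³`; the transfer needs it sector-wise inside the Dirichlet minimiser of the big box (Neumann
bracketing + convexity in the sector occupation), and hard cores are unpinned in print.  WEAKER than the
conjunct: blind to the relative phases of distinct horizon blocks AND to everything inside a GP block.
[cite: Junge2026, Thm. 4 and Cor. 6 (26)–(28); FournaisEtAl2024 = arXiv:2408.14222, Thm. 1.3] -/
@[conjecture] def GroundStateTwoScaleDepletion (η : ℝ≥0) : Prop :=
  ∀ v : ℝ → ℝ≥0∞, IsRepulsiveFiniteRange v → 0 < scatteringLength v →
    ∀ s : ℝ, 0 < s → ∀ M : ℝ, 0 < M → ∀ A : ℝ, 0 < A → ∃ ρ₀ : ℝ, 0 < ρ₀ ∧ ∀ ρ : ℝ, 0 < ρ → ρ < ρ₀ →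
      ∀ᶠ n : ℕ in atTop,
        (∃ Ψ₀ : Config (n + 1) → ℝ, (∀ X, 0 ≤ Ψ₀ X) ∧
          IsGroundState v (sideLength ρ (n + 1)) (fun X => (Ψ₀ X : ℂ))) →
        ∀ K : ℕ, 0 < K → InWindow (M * ρ ^ (-(η : ℝ))) ρ (sideLength ρ (n + 1)) K →
        ∀ j : ℕ, 0 < j → InWindow A ρ (sideLength ρ (n + 1)) (K * j) →
          blockDepletion (sideLength ρ (n + 1)) K (groundState v (n + 1) (sideLength ρ (n + 1))) ≤
            blockDepletion (sideLength ρ (n + 1)) (K * j)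
                (groundState v (n + 1) (sideLength ρ (n + 1))) + ENNReal.ofReal s

/-- **LAB_h(η)** (crux · DECLARED RESIDUAL of gen 34 · TAG UNDECIDED-DIAGONAL · WEAKER THAN g33's LAB ·
leaf IDEA-NEEDED) `GroundStateHorizonLabelAffinity η`: for `a > 0` there are `c > 0` and a horizon constant
`M > 0` such that, below a density cap, eventually in `N`, the nonnegative ground state `Ψ₀` (when one exists)
has block-label affinity `≥ c` for every block number `K` of the HORIZON window
`L/K ∈ [Mρ^{-η}/√ρ, 2Mρ^{-η}/√ρ]`: the conditional law of «which HORIZON block (side `≍ ξ(ρa³)^{-η}`,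
`≍ ρξ³(ρa³)^{-3η} → ∞` particles each) holds particle 1, given the other `N − 1` particles» stays, on
`P̂`-average, Hellinger-comparable to the uniform law on the `K³` horizon blocks.  A statement about the
DIAGONAL measure `|Ψ₀|²` only, at a scale STRICTLY ABOVE the reach of every energy / gap functional
(`KineticGapLengthScales*`: the energy cannot see beyond the horizon) — quantitative NON-RIGIDITY of the
`|Ψ₀|²` point process for HORIZON-SIZED cells.  WEAKER than g33's `GroundStateLabelAffinity` (= the case
`η = 0`, `horizonLabelAffinity_zero_iff`) by REFINEMENT MONOTONICITY (`labelAffinity_mul_le`,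
`horizonLabelAffinity_mono`), and still sufficient: `bec_of_horizonAffinity`.  Its defect is parametrically
small in the true regime (expected `1 − labelAffinity ≲ (ξ/ℓ_h)² + D(K_h) → 0`, against `O(A⁻²)` at the GP
scale), so even `c ↑ 1` is TRUE-type.  Why it might fail / why undecided: nothing in print controls the number
rigidity of `|Ψ₀|²` for interacting continuum bosons at ANY mesoscopic scale; the horizon scale removes the
energy method as a competitor but not the need for a positivity / insertion-tolerance idea
(cf. [GhoshPeres2017] rigidity–tolerance dichotomy; the solo-blind «lemma M» wall is about the sup-norm
oscillation at the GAP scale, two levels finer than what is asked here).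
[cite: GhoshPeres2017, rigidity–tolerance dichotomy, DOI 10.1215/00127094-2017-0002; LSSY2005 Thm 7.1; Junge2026 Cor. 6] -/
@[conjecture] def GroundStateHorizonLabelAffinity (η : ℝ≥0) : Prop :=
  ∀ v : ℝ → ℝ≥0∞, IsRepulsiveFiniteRange v → 0 < scatteringLength v →
    ∃ c : ℝ, 0 < c ∧ ∃ M : ℝ, 0 < M ∧ ∃ ρ₀ : ℝ, 0 < ρ₀ ∧ ∀ ρ : ℝ, 0 < ρ → ρ < ρ₀ →
      ∀ᶠ n : ℕ in atTop,
        (∃ Ψ₀ : Config (n + 1) → ℝ, (∀ X, 0 ≤ Ψ₀ X) ∧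
          IsGroundState v (sideLength ρ (n + 1)) (fun X => (Ψ₀ X : ℂ))) →
        ∀ K : ℕ, 0 < K → InWindow (M * ρ ^ (-(η : ℝ))) ρ (sideLength ρ (n + 1)) K →
          ENNReal.ofReal c ≤
            labelAffinity (sideLength ρ (n + 1)) K (groundState v (n + 1) (sideLength ρ (n + 1)))

/-- At `η = 0` the horizon pieces ARE g33's: `LOC_h(0) ↔ LOC`. [folklore] -/
theorem horizonCondensation_zero_iff :
    GroundStateHorizonCondensation 0 ↔ GroundStateBlockCondensation := by
  unfold GroundStateHorizonCondensation GroundStateBlockCondensation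
  simp only [NNReal.coe_zero, neg_zero, Real.rpow_zero, mul_one]

/-- At `η = 0` the horizon pieces ARE g33's: `LAB_h(0) ↔ LAB`. [folklore] -/
theorem horizonLabelAffinity_zero_iff :
    GroundStateHorizonLabelAffinity 0 ↔ GroundStateLabelAffinity := by
  unfold GroundStateHorizonLabelAffinity GroundStateLabelAffinity
  simp only [NNReal.coe_zero, neg_zero, Real.rpow_zero, mul_one]

/-- **LAB_h is MONOTONE (weaker) in the scale exponent**: `η ≤ η' ⇒ LAB_h(η) → LAB_h(η')` — from the window
of `Mρ^{-η'}` refine into the window of `Mρ^{-η}` (`exists_mul_inWindow`, density cap `ρ ≤ 1`) and use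
refinement monotonicity `labelAffinity_mul_le`. [folklore] -/
theorem horizonLabelAffinity_mono {η η' : ℝ≥0} (hηη' : η ≤ η') :
    GroundStateHorizonLabelAffinity η → GroundStateHorizonLabelAffinity η' := by
  intro hlab v hv ha
  obtain ⟨c, hc, M, hM, ρ₀, hρ₀, h⟩ := hlab v hv ha
  refine ⟨c, hc, M, hM, min ρ₀ 1, lt_min hρ₀ one_pos, fun ρ hρ hρlt => ?_⟩
  have h0 : ρ < ρ₀ := hρlt.trans_le (min_le_left _ _)
  have h1 : ρ ≤ 1 := (hρlt.trans_le (min_le_right _ _)).le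
  have hA : 0 < M * ρ ^ (-(η : ℝ)) := mul_pos hM (Real.rpow_pos_of_pos hρ _)
  have hAA' : M * ρ ^ (-(η : ℝ)) ≤ M * ρ ^ (-(η' : ℝ)) :=
    mul_rpow_neg_mono hM.le hρ h1 (NNReal.coe_le_coe.2 hηη')
  filter_upwards [h ρ hρ h0] with n hn hex K hK hKw
  obtain ⟨j, hj, hjw⟩ := exists_mul_inWindow hA hAA' hρ hK hKw
  have hL : 0 < sideLength ρ (n + 1) := sideLength_pos_of_inWindow hA hρ (Nat.mul_pos hK hj) hjw
  exact (hn hex (K * j) (Nat.mul_pos hK hj) hjw).trans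
    (labelAffinity_mul_le hL hK hj (measurable_groundState v (n + 1) _))

/-- **The g34 residual is WEAKER than the g33 residual**: `LAB → LAB_h(η)` for every `η`. [folklore] -/
theorem horizonLabelAffinity_of_labelAffinity (η : ℝ≥0) :
    GroundStateLabelAffinity → GroundStateHorizonLabelAffinity η := fun h =>
  horizonLabelAffinity_mono (by positivity) (horizonLabelAffinity_zero_iff.2 h)

/-- **LOC_h(η) ⟸ LOC ∧ TSD(η)**: the horizon depletion is the GP-block depletion of a nested
refinement plus the two-scale (Junge) depletion — both ENERGY-CLASS, both in print. [folklore] -/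
theorem horizonCondensation_of_loc_twoScale (η : ℝ≥0)
    (hloc : GroundStateBlockCondensation) (htsd : GroundStateTwoScaleDepletion η) :
    GroundStateHorizonCondensation η := by
  intro v hv ha s hs M hM
  obtain ⟨ρ₁, hρ₁, h1⟩ := hloc v hv ha (s / 2) (by positivity) M hM
  obtain ⟨ρ₂, hρ₂, h2⟩ := htsd v hv ha (s / 2) (by positivity) M hM M hM
  refine ⟨min (min ρ₁ ρ₂) 1, lt_min (lt_min hρ₁ hρ₂) one_pos, fun ρ hρ hρlt => ?_⟩
  have hr1 : ρ < ρ₁ := hρlt.trans_le ((min_le_left _ _).trans (min_le_left _ _))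
  have hr2 : ρ < ρ₂ := hρlt.trans_le ((min_le_left _ _).trans (min_le_right _ _))
  have hr3 : ρ ≤ 1 := (hρlt.trans_le (min_le_right _ _)).le
  have hA : 0 < M * ρ ^ (-(0 : ℝ)) := mul_pos hM (Real.rpow_pos_of_pos hρ _)
  have hAA' : M * ρ ^ (-(0 : ℝ)) ≤ M * ρ ^ (-(η : ℝ)) := mul_rpow_neg_mono hM.le hρ hr3 η.2
  have hM0 : M * ρ ^ (-(0 : ℝ)) = M := by rw [neg_zero, Real.rpow_zero, mul_one]
  filter_upwards [h1 ρ hρ hr1, h2 ρ hρ hr2] with n h1n h2n hex K hK hKw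
  obtain ⟨j, hj, hjw⟩ := exists_mul_inWindow hA hAA' hρ hK hKw
  rw [hM0] at hjw
  calc blockDepletion (sideLength ρ (n + 1)) K (groundState v (n + 1) (sideLength ρ (n + 1)))
      ≤ blockDepletion (sideLength ρ (n + 1)) (K * j) (groundState v (n + 1) (sideLength ρ (n + 1))) +
          ENNReal.ofReal (s / 2) := h2n hex K hK hKw j hj hjw
    _ ≤ ENNReal.ofReal (s / 2) + ENNReal.ofReal (s / 2) :=
        add_le_add (h1n hex (K * j) (Nat.mul_pos hK hj) hjw) le_rfl
    _ = ENNReal.ofReal s := by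
        rw [← ENNReal.ofReal_add (by positivity) (by positivity)]; congr 1; ring

/-- **The residual is ONE scale-free number** (converse direction, modulo the energy-class piece):
`LOC_h(η) ∧ LAB_h(η) ⟹ LAB` — indeed label affinity `≥ c/2` at EVERY block number whatsoever (the GP constant
returned is `A = 1`, and the window hypothesis is not even used): ONE horizon block number `K` with `D(K) ≤ (c/2)²`
and `LAB(K) ≥ c` forces `BC(u_L) ≥ c/2`, and `BC(u_L) ≤ LAB(K')` for all `K'` (`labelAffinity_le_labelAffinity_add`).
Together with `horizonLabelAffinity_of_labelAffinity` (LAB ⟹ LAB_h(η), unconditionally): modulo LOC_h(η) the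
g33 residual and the g34 residual are EQUIVALENT, and no placement of the diagonal residual on the scale axis
inside the energy-sighted region is weaker than LAB_h — the scale axis is exhausted. [folklore] -/
theorem labelAffinity_of_horizonPieces (η : ℝ≥0) (hloc : GroundStateHorizonCondensation η)
    (hlab : GroundStateHorizonLabelAffinity η) : GroundStateLabelAffinity := by
  have rpow_half_sq : ∀ m : ℝ≥0∞, (m ^ 2) ^ (1 / 2 : ℝ) = m := fun m => by
    rw [← ENNReal.rpow_two, ← ENNReal.rpow_mul]; norm_num
  intro v hv ha
  obtain ⟨c, hc, M, hM, ρ₁, hρ₁, hlab'⟩ := hlab v hv ha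
  obtain ⟨ρ₂, hρ₂, hloc'⟩ := hloc v hv ha ((c / 2) ^ 2) (by positivity) M hM
  refine ⟨c / 2, by positivity, 1, one_pos, min ρ₁ ρ₂, lt_min hρ₁ hρ₂, fun ρ hρ hρlt => ?_⟩
  have h1 : ρ < ρ₁ := hρlt.trans_le (min_le_left _ _)
  have h2 : ρ < ρ₂ := hρlt.trans_le (min_le_right _ _)
  have hsρ : 0 < Real.sqrt ρ := Real.sqrt_pos.2 hρ
  have hA : 0 < M * ρ ^ (-(η : ℝ)) := mul_pos hM (Real.rpow_pos_of_pos hρ _)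
  have hLn : ∀ᶠ n : ℕ in atTop, 2 * (M * ρ ^ (-(η : ℝ))) / Real.sqrt ρ ≤ sideLength ρ (n + 1) :=
    (tendsto_sideLength_succ_atTop hρ).eventually_ge_atTop _
  filter_upwards [hlab' ρ hρ h1, hloc' ρ hρ h2, hLn] with n hlabn hlocn hLn hex K' hK' _hK'w
  set L := sideLength ρ (n + 1) with hLdef
  have hLbig : 2 * (M * ρ ^ (-(η : ℝ))) ≤ L * Real.sqrt ρ := (div_le_iff₀ hsρ).1 hLn
  have hL : 0 < L := by
    by_contra h
    nlinarith [hsρ.le, not_lt.1 h, hLbig, hA]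
  obtain ⟨K, -, hK, hKw⟩ := exists_even_inWindow hA hρ hLbig
  set Φ := groundState v (n + 1) L with hΦdef
  have hΦm : Measurable Φ := measurable_groundState v (n + 1) L
  have hΦ1 : ∫⁻ Y : Config n, ∫⁻ x, ENNReal.ofReal (Φ (Matrix.vecCons x Y)) ^ 2 = 1 := by
    rw [← lintegral_eq_lintegral_lintegral_vecCons (hΦm.ennreal_ofReal.pow_const 2)]
    exact lintegral_groundState_sq hex
  have hs : blockDepletion L K Φ ^ (1 / 2 : ℝ) ≤ ENNReal.ofReal (c / 2) := by
    have hD : blockDepletion L K Φ ≤ ENNReal.ofReal ((c / 2) ^ 2) := hlocn hex K hK hKw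
    calc blockDepletion L K Φ ^ (1 / 2 : ℝ)
        ≤ (ENNReal.ofReal ((c / 2) ^ 2)) ^ (1 / 2 : ℝ) := ENNReal.rpow_le_rpow hD (by norm_num)
      _ = ENNReal.ofReal (c / 2) := by rw [ENNReal.ofReal_pow (by positivity), rpow_half_sq]
  have key := labelAffinity_le_labelAffinity_add hL hK hK' hΦm hΦ1
  have hcK : ENNReal.ofReal c ≤ labelAffinity L K Φ := hlabn hex K hK hKw
  calc ENNReal.ofReal (c / 2) = ENNReal.ofReal c - ENNReal.ofReal (c / 2) := by
        rw [← ENNReal.ofReal_sub c (by positivity)]; congr 1; ring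
    _ ≤ labelAffinity L K Φ - blockDepletion L K Φ ^ (1 / 2 : ℝ) := tsub_le_tsub hcK hs
    _ ≤ labelAffinity L K' Φ := tsub_le_iff_right.2 key

/-- **DECIDING KERNEL OF GEN 34** (0 sorry): DOOR → UGS → LOC_h(η) → LAB_h(η) → the conjunct
`BoseEinsteinCondensation`, for EVERY `η` — g33's kernel run at the horizon window (`a = 0` by the tree's
`zeroScatteringBEC_holds`; `a > 0`: `s = c/2`, an even `K` in the horizon window (`exists_even_inWindow` with
constant `Mρ^{-η}`), `mul_sq_le_maxOccupation`, and the ground-state door with constant `c²/4`). [folklore] -/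
theorem bec_of_horizonAffinity (η : ℝ≥0) (hdoor : GroundStateDoor) (hU : BoxGroundStateUniqueness)
    (hloc : GroundStateHorizonCondensation η) (hlab : GroundStateHorizonLabelAffinity η) :
    _root_.BoseEinsteinCondensation := by
  intro v hv
  by_cases ha : 0 < scatteringLength v
  swap
  · exact zeroScatteringBEC_holds v hv (le_zero_iff.1 (not_lt.1 ha))
  obtain ⟨c, hc, M, hM, ρ₁, hρ₁, hlab'⟩ := hlab v hv ha
  obtain ⟨ρ₂, hρ₂, hloc'⟩ := hloc v hv ha ((c / 2) ^ 2) (by positivity) M hM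
  obtain ⟨ρ₃, hρ₃, hU'⟩ := hU v hv ha
  refine ⟨min ρ₁ (min ρ₂ ρ₃), lt_min hρ₁ (lt_min hρ₂ hρ₃), fun ρ hρ hρlt => ?_⟩
  have h1 : ρ < ρ₁ := hρlt.trans_le (min_le_left _ _)
  have h2 : ρ < ρ₂ := hρlt.trans_le ((min_le_right _ _).trans (min_le_left _ _))
  have h3 : ρ < ρ₃ := hρlt.trans_le ((min_le_right _ _).trans (min_le_right _ _))
  have hsρ : 0 < Real.sqrt ρ := Real.sqrt_pos.2 hρ
  -- the horizon window constant at this density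
  have hA : 0 < M * ρ ^ (-(η : ℝ)) := mul_pos hM (Real.rpow_pos_of_pos hρ _)
  set A : ℝ := M * ρ ^ (-(η : ℝ)) with hAdef
  -- the occupation floor along `N = n + 1`
  have hev : ∀ᶠ n : ℕ in atTop, ENNReal.ofReal ((c / 2) ^ 2 * ((n + 1 : ℕ) : ℝ)) ≤
      maxOccupation (n + 1) (fun X => (groundState v (n + 1) (sideLength ρ (n + 1)) X : ℂ)) := by
    have hUn : ∀ᶠ n : ℕ in atTop, HasUniqueGroundState v (n + 1) (sideLength ρ (n + 1)) :=
      (tendsto_add_atTop_nat 1).eventually (hU' ρ hρ h3)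
    have hLn : ∀ᶠ n : ℕ in atTop, 2 * A / Real.sqrt ρ ≤ sideLength ρ (n + 1) :=
      (tendsto_sideLength_succ_atTop hρ).eventually_ge_atTop _
    filter_upwards [hlab' ρ hρ h1, hloc' ρ hρ h2, hUn, hLn] with n hlabn hlocn hUn hLn
    set L := sideLength ρ (n + 1) with hLdef
    have hLbig : 2 * A ≤ L * Real.sqrt ρ := (div_le_iff₀ hsρ).1 hLn
    have hL : 0 < L := by
      by_contra h
      nlinarith [hsρ.le, not_lt.1 h, hLbig, hA]
    obtain ⟨K, -, hK, hKw⟩ := exists_even_inWindow hA hρ hLbig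
    have hex : ∃ Ψ₀ : Config (n + 1) → ℝ, (∀ X, 0 ≤ Ψ₀ X) ∧
        IsGroundState v L (fun X => (Ψ₀ X : ℂ)) := hUn.1
    set Φ := groundState v (n + 1) L with hΦdef
    have hΦ0 : 0 ≤ Φ := fun X => groundState_nonneg v (n + 1) L X
    have hΦm : Measurable Φ := measurable_groundState v (n + 1) L
    have hΦ1 : ∫⁻ Y : Config n, ∫⁻ x, ENNReal.ofReal (Φ (Matrix.vecCons x Y)) ^ 2 = 1 := by
      rw [← lintegral_eq_lintegral_lintegral_vecCons (hΦm.ennreal_ofReal.pow_const 2)]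
      exact lintegral_groundState_sq hex
    have hs : blockDepletion L K Φ ≤ ENNReal.ofReal (c / 2) ^ 2 := by
      rw [← ENNReal.ofReal_pow (by positivity)]
      exact hlocn hex K hK hKw
    have key := mul_sq_le_maxOccupation hL hK hΦ0 hΦm hΦ1 (hlabn hex K hK hKw) hs
    have hsub : ENNReal.ofReal c - ENNReal.ofReal (c / 2) = ENNReal.ofReal (c / 2) := by
      rw [← ENNReal.ofReal_sub c (by positivity)]
      congr 1; ring
    rw [hsub] at key
    calc ENNReal.ofReal ((c / 2) ^ 2 * ((n + 1 : ℕ) : ℝ))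
        = (n + 1 : ℝ≥0∞) * ENNReal.ofReal (c / 2) ^ 2 := by
          rw [ENNReal.ofReal_mul (by positivity), ENNReal.ofReal_natCast,
            ENNReal.ofReal_pow (by positivity), mul_comm]
          push_cast; rfl
      _ ≤ maxOccupation (n + 1) (fun X => (Φ X : ℂ)) := key
  -- shift `n + 1 ↦ N` and close through the ground-state door
  have hev' : ∀ᶠ N : ℕ in atTop, ENNReal.ofReal ((c / 2) ^ 2 * (N : ℝ)) ≤
      maxOccupation N (fun X => (groundState v N (sideLength ρ N) X : ℂ)) := by
    rw [← Filter.map_add_atTop_eq_nat 1, Filter.eventually_map]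
    exact hev
  exact hdoor v ρ hρ ((c / 2) ^ 2) (by positivity) (hU' ρ hρ h3) hev'

/-- **THE GEN-34 NODE, assembled** (0 sorry): for every `η : ℝ≥0`,
`BoseEinsteinCondensation ⟸ DOOR ∧ UGS ∧ LOC ∧ TSD(η) ∧ LAB_h(η)` — g33's line with its residual LAB
REPLACED by the WEAKER horizon residual LAB_h(η) (`horizonLabelAffinity_of_labelAffinity`) at the price of
the energy-class, fact-backed two-scale depletion TSD(η). [folklore] -/
theorem bec_of_twoScaleAffinity (η : ℝ≥0) (hdoor : GroundStateDoor)
    (hU : BoxGroundStateUniqueness) (hloc : GroundStateBlockCondensation)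
    (htsd : GroundStateTwoScaleDepletion η) (hlab : GroundStateHorizonLabelAffinity η) :
    _root_.BoseEinsteinCondensation :=
  bec_of_horizonAffinity η hdoor hU (horizonCondensation_of_loc_twoScale η hloc htsd) hlab

/-- **g33 is the case `η = 0`** (sanity: the g34 kernel specialises to `bec_of_labelAffinity`). [folklore] -/
theorem bec_of_labelAffinity' (hdoor : GroundStateDoor) (hU : BoxGroundStateUniqueness)
    (hloc : GroundStateBlockCondensation) (hlab : GroundStateLabelAffinity) :
    _root_.BoseEinsteinCondensation :=
  bec_of_horizonAffinity 0 hdoor hU (horizonCondensation_zero_iff.2 hloc)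
    (horizonLabelAffinity_zero_iff.2 hlab)

/-- **THE GEN-34 NODE, door discharged** (0 sorry; hypotheses = the pieces only):
UGS → LOC_h(η) → LAB_h(η) → `BoseEinsteinCondensation`. [folklore] -/
theorem bec_of_horizonAffinity₀ (η : ℝ≥0) (hU : BoxGroundStateUniqueness)
    (hloc : GroundStateHorizonCondensation η) (hlab : GroundStateHorizonLabelAffinity η) :
    _root_.BoseEinsteinCondensation :=
  bec_of_horizonAffinity η groundStateDoor_holds hU hloc hlab

/-- **THE GEN-34 NODE, assembled and door discharged** (0 sorry):
UGS → LOC → TSD(η) → LAB_h(η) → `BoseEinsteinCondensation`. [folklore] -/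
theorem bec_of_twoScaleAffinity₀ (η : ℝ≥0) (hU : BoxGroundStateUniqueness)
    (hloc : GroundStateBlockCondensation) (htsd : GroundStateTwoScaleDepletion η)
    (hlab : GroundStateHorizonLabelAffinity η) : _root_.BoseEinsteinCondensation :=
  bec_of_twoScaleAffinity η groundStateDoor_holds hU hloc htsd hlab


end Summit.AtomisticToContinuum.BoseEinsteinCondensation.Theorems.BoxHorizonAffinity
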